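import Summits.FinalStateConjecture.FinalStateConjecture.Theses.SwallowTheDatum
import Summits.FinalStateConjecture.FinalStateConjecture.Theorems.KerrShieldedDataExist.Negative.BentSliceConormal

/-!
# Line `tapered-temporal-collar` for crux `SwallowTheDatum.KerrShieldedSettles`
# (item stmt-FinalStateConjecture-10054) — crux-plan skeleton (planner, 2026-08-16)

Idea card: `Cruxes/KerrShieldedSettles/Ideas/tapered-temporal-collar.md` (round 2, triage r2-1/2/3: pass;
merged lever with `three-clocks-pinched-development` / `pinched-sandwich-cauchy`).

THE LEVER (stub `stub_collarCauchy`, S1).  The sub-development that item 10053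
(`SubdataDevelopmentsEmbed`) embeds into every MGHD is the EXPLICIT open subset of the ingoing
Kerr–Schild chart
  `W := {x ∈ Kerr.region a r₁ | u(x) + (r(x) − r₁)/4 > 0}`,  `u := t* − T_{M,a}(r)`,
the whole future of the bent data leaf `Σᵉ = {u = 0}` plus a past collar whose thickness tapers
linearly to zero at the inner edge `r = r₁`; `Σᵉ` is a Cauchy hypersurface of `W` by ORDER THEORY
for the two temporal functions `u` and `w := u + (r − r₁)/4` (both have timelike differential:
landed `conormalForm_*` lemmas of `Theorems/KerrShieldedDataExist/Negative/BentSliceConormal.lean`,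
Disproof.lean §B′/§E `conormalSq_*_neg`, and the hole inequality `conormalSq M a r z² (−c) ≤ −1`
for `c ≤ 1/2`, triage r2-3 S1), the hole clock (`dr` timelike on `r₋ < r < r₊`, `dr(V) = −2H`),
the Kerr–Schild speed limit `|ẋ⃗| ≤ ṫ*` and `0 ≤ T ≤ 2.2 M log(r/M) + C`.

THE REST OF THE LINE (why the skeleton concludes the crux).  S2 `stub_kerrVacuum` (Kerr–Schild is
Ricci-flat: the tree's unproved named fact `Kerr.isRicciFlat`, the shared debt of every line, Disproof
§H4).  S3 `stub_collarEmbedsMGHD`: from S1 + S2 build the `VacuumCauchyDevelopment` of the pulled-back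
data `D.comap φ` with carrier `W`, embedding `ψ`, normal `ν` (`DataEmbedding` into `Kerr.spacetime M a r₁`
+ the `CauchyDevelopmentRestrict` pattern), apply `SubdataDevelopmentsEmbed` (route item 10053, taken
BY NAME as the hypothesis of `KerrShieldedSettles_of`) and unfold the embedding `χ` at chart level
(smooth + open embedding on `W`, `χ^* g_𝒟 = g_{M,a}`, `dχ(V)` future, `χ ∘ ψ = ι ∘ φ`, `dχ ν = ν_𝒟 ∘ φ`).
S4 `stub_kerrLeafSojourn` (pure Kerr optics from the bent leaf: every normalised future null ray from
radius `≥ R₁` is future complete in the chart or banks sojourn `≥ s` in `J⁺(ψ{r ≤ R₀})` before it can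
reach `r₊ > r₁` — the two-speed / speed-limit engine of the sibling cards) and S5 `stub_scriTransport`
(inner-edge capping `X ∖ φ{r > R} ` compact from admissibility, transport of maximal null geodesics and
of `J⁺` through `χ`) give clause (a) `HasCompleteNullInfinity`.  S6 `stub_kerrExteriorDecomposition`
(the `N = 1` receding-bend charts of Disproof §C3/§F/§I in the chart, with images in
`O_K := {r > r₊, u ≥ 0}`, `HasExhaustiveCharts`, and `O_K ⊆ J⁺(Σᵉ) ∩ I⁻(charted)`) and
S7 `stub_exteriorTransport` (Disproof §C1 LAST-EXIT argument: `exteriorOf 𝒟 (χ charted) = χ(O_K)`,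
using only achronality of `ι X` in `𝒟`, Hausdorffness and the chart clocks; push-forward of the
decomposition through the isometry `χ`) give clauses (b)+(c).  `KerrShieldedSettles_of` is pure logic.

Conventions.  `T = bentHeight M a` is by `rfl` the crux's hard-coded lambda
(`bentHeight_eq_literal`).  `W`-membership of `x : Kerr.region a r₁` is written
`0 < x⁰ − T(r x) + (r x − r₁)/4`; the leaf is `x⁰ = T(r x)`; `O_K` is `r₊ < r x ∧ T(r x) ≤ x⁰`.
Every stub is stated over tree vocabulary only (no local definitions), so that each can be landed
verbatim as `Theorems/KerrShieldedSettles<Stub>.lean --supports stmt-FinalStateConjecture-10054`.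
The two pull-back identities of the shield are consumed in their pointwise (`pullbackBilin_apply`)
form; `KerrShieldedSettles_of` performs that unfolding.

Imports / negative-lemma check: the landed Negative lane `KerrShieldedDataExist/Negative/BentSliceConormal`
(`bentHeight`, `bentSlope`, `conormalForm_bentSlope_neg`, `radius_ofTimeSpace`, `psi_eq_graph`) is imported; the
crux's own Negative lane `Theorems/KerrShieldedSettles/Negative/StationaryBendDead.lean`
(`not_tendsto_stationaryBend_dev` — the refuted STATIONARY hole bend, which S6 avoids by receding;
`bentHeight_le_two_mul_log` — wanted by S1/S6) was read at source level; its import is left out only because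
the farm reported the module `unbuilt` (rc 75) at planning time — the lead should add it back once it is built.
No stub is an instance of a landed negative lemma (S6 prescribes no stationary bend; nothing else is chart-specific).

Disproof.lean (rev 4) used: no `_false_without_` theorem exists (§A/§D); S5 honours §H1
(admissibility — completeness — is consumed exactly at the inner-edge capping); S6 honours §G
(`Theorems/KerrShieldedSettles/Negative/StationaryBendDead.lean`: the hole chart's bend RECEDES, it is
not the stationary bend) and `not_exists_unbent_bound` (flat chart bent by the full `T`); S7 is §C1;
S1's set is one-sided to the future with a tapering past collar, i.e. NOT the refuted fixed-thickness
band of TRIAGE r1-2 T5.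
-/

noncomputable section

open Set Filter
open scoped Manifold ContDiff Topology
open Literature.Geometry.Lorentzian
open Summit.FinalStateConjecture.FinalStateConjecture.Theses.SwallowTheDatum
open Summit.FinalStateConjecture.FinalStateConjecture.Theorems.KerrShieldedDataExist.Negative
  (bentHeight bentHeight_eq_literal)

namespace Summit.FinalStateConjecture.FinalStateConjecture.Cruxes.KerrShieldedSettles.TaperedTemporalCollar

set_option linter.unusedVariables false
set_option linter.dupNamespace false

/-! ## S1 — the tapered temporal collar (THE lever of the line) -/

/-- **S1 `stub_collarCauchy` — the bent leaf is a Cauchy hypersurface of the tapered collar `W`.**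
For sub-extremal `(M, a)`, `0 ≤ M`, and a junction radius `r₋ < r₁ < r₊`, every future-timelike curve
`γ` of the ingoing Kerr–Schild chart `Kerr.region a r₁` on a parameter interval `s` which lies in
`W = {x | 0 < x⁰ − T(r x) + (r x − r₁)/4}` and has NO endpoint in `W` (i.e. is endless as a curve of the
open sub-spacetime `W`; `HasFutureEndpoint`/`HasPastEndpoint` of `Causality.lean`) meets the leaf
`Σᵉ = {x⁰ = T(r x)}` EXACTLY ONCE.  (Unfolded `LorentzianMetric.IsCauchyHypersurface` of `Σᵉ` in
`(W, g|_W, τ|_W)` via `isFutureTimelikeCurveOn_restrict_iff` / `hasFutureEndpoint_subtypeVal_comp_iff`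
of `OpensCausality.lean`; slightly stronger since `γ` is unconstrained off `s`.)
Proof plan (idea card + triage): `u = x⁰ − T(r)` and `w = u + (r − r₁)/4` strictly increase along
future timelike curves (conormals `dt* − T′dr`, `dt* − (T′ − ¼)dr` timelike: `conormalForm_bentSlope_neg`,
convexity in the slope on `Δ ≥ 0`, `conormalSq(−c) ≤ −1` in the hole for `c ≤ ½`; co-orientation
`n(V) = 1 + 2H(1 + y) > 0`); `≤ 1` crossing by monotonicity of `u`; existence by the escape trichotomy:
`u > 0` throughout ⇒ pastward `t* ≥ u + T ≥ 0` is bounded, the speed limit `|ẋ⃗| ≤ ṫ*`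
(`KerrSchild.Background.coneCovector_causal`) gives an `E4`-limit `q`; `r(q) > r₁` contradicts "no past
endpoint in `W`" (`u(q) ≥ 0`), `r(q) = r₁` contradicts the hole clock (`dr(v) < 0` for future causal `v` on
`r₋ < r < r₊`, `Kerr.horizonCovector_causal`-type covector argument); `u < 0` throughout ⇒ futureward either
an `E4`-limit `q` with `w(q) ≤ 0 < lim w` (taper!), or `t* → +∞` with `T(r) > t*`, impossible since
`r ≤ ‖x⃗‖ + |a| ≤ C + t*` and `T ≤ 2.2 M log(r/M) + C` (`bentHeight_le_two_mul_log`, Disproof §G′).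
Template: `Minkowski.isCauchyHypersurface_range_sliceEmbed` (MinkowskiCauchy.lean).  Size M–L. -/
theorem stub_collarCauchy : ∀ [Kerr.Facts] (M a r₁ : ℝ) (hM : 0 ≤ M), |a| < M →
    Kerr.rMinus M a < r₁ → r₁ < Kerr.rPlus M a →
    ∀ (γ : ℝ → Kerr.region a r₁) (s : Set ℝ), s.OrdConnected → s.Nonempty →
      (Kerr.smoothMetric M a r₁).IsFutureTimelikeCurveOn
          ((Kerr.timeOrientation M a r₁ hM).ofLE le_top) γ s →
      (∀ t ∈ s, 0 < (γ t : E4) 0 - bentHeight M a (Kerr.radius a (γ t : E4)) +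
          (Kerr.radius a (γ t : E4) - r₁) / 4) →
      (∀ q : Kerr.region a r₁, 0 < (q : E4) 0 - bentHeight M a (Kerr.radius a (q : E4)) +
          (Kerr.radius a (q : E4) - r₁) / 4 →
            ¬ HasFutureEndpoint γ s q ∧ ¬ HasPastEndpoint γ s q) →
      ∃! t, t ∈ s ∧ (γ t : E4) 0 = bentHeight M a (Kerr.radius a (γ t : E4)) := by
  sorry

/-! ## S2 — Kerr–Schild Kerr is vacuum (shared debt of every line; Disproof §H4) -/

/-- **S2 `stub_kerrVacuum` — the Kerr metric is Ricci-flat on the whole ingoing Kerr–Schild chart**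
(the tree's UNPROVED named fact `Kerr.isRicciFlat M a r₀`, unfolded: `∀ [HasLeviCivita], ∀ x, Ric_x = 0`).
Kerr PRL 11 (1963); Kerr–Schild 1965 §3; O'Neill 1995 Thm. 2.6.1.  In Kerr–Schild form `g = η + 2Hℓ⊗ℓ`
with `ℓ` null geodesic shear-free for `η`, `Ric(g)` is LINEAR in `H ℓ⊗ℓ` and vanishes for
`H = M r³/(r⁴ + a²z²)` (a symbolic identity on `{r > 0}`; all real `M, a`).  Tree support:
`KerrSchild.lean` (`bilin`, `nullVector`, `radius_quartic`), `ChartCurvature`/`CoordCurvature` (Christoffel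
and Ricci in a single chart), `Minkowski.isRicciFlat_holds` (template).  Size L (computer-algebra-sized
identity; consider `kit` to generate the certificate).  Needed only at `r₀ = r₁`. -/
theorem stub_kerrVacuum : ∀ [Kerr.Facts] (M a r₀ : ℝ) [(Kerr.metric M a r₀).HasLeviCivita]
    (x : Kerr.region a r₀), (Kerr.metric M a r₀).ricci x = 0 := by
  sorry

/-! ## S3 — the collar is a vacuum Cauchy development of the pulled-back data and embeds into every MGHD -/

/-- **S3 `stub_collarEmbedsMGHD` — build `W` as a `VacuumCauchyDevelopment (D.comap φ …)` and embed it.**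
Given the shield (sub-extremal `(M,a)`, window `r₋ < r₁ < r₊`, `φ : Kerr.slice a r₁ → X` a smooth open
embedding, `ψ` = graph of `T = bentHeight M a` over the slice, spacelike, future unit normal `ν`,
`φ^*h = ψ^*g_{M,a}` and `φ^*k = K_ν(ψ)` pointwise), the collar Cauchy property (S1's conclusion, hypothesis
`hC`) and `Ric(g_{M,a}) = 0` on the chart (S2, hypothesis `hRic`), and the route item
`SubdataDevelopmentsEmbed` (10053): for every MAXIMAL vacuum Cauchy development `𝒟` of `D` there is a map
`χ : Kerr.region a r₁ → 𝒟` (junk off `W`) which on `W` is smooth, an open embedding, isometric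
(`g_𝒟(dχ v, dχ w) = g_{M,a}(v, w)`), time-orientation preserving (`dχ V` future, `V = −g♯dt*`), with
`χ ∘ ψ = ι_𝒟 ∘ φ` and `dχ (ν y) = ν_𝒟 (φ y)`.
Proof plan: (i) `DataEmbedding (D.comap φ hφ hφ′)` with spacetime `Kerr.spacetime M a r₁ hM`, `embed := ψ`
(smooth embedding: graph of the `C^∞` height `contDiff`/`hasDerivAt_bentHeight` over an open set),
`normal := ν`, `induced_h` from `hh` + `comap_h_inner`, `induced_k` from `hk` + `kBilin_apply`; `dφ`
injective because `φ^*h = ψ^*g` is positive definite (`hsp`); (ii) `W` is open, CONNECTED (homeomorphic to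
`Kerr.region a r₁` by `(t, y⃗) ↦ (f(y⃗) + eᵗ, y⃗)`, `Kerr.Facts.isConnected_region`), contains `range ψ`
(`u = 0`, `r > r₁`), and `range ψ` is Cauchy in `W` by `hC`; restrict as in
`CauchyDevelopmentRestrict.lean` (`DataEmbedding.restrict`, smoothness of `ν`: it equals the explicit
normal `−g♯du/|du|` by `TimeOrientation.eq_of_isFutureUnitNormal`), vacuum by `isRicciFlat_restrict` + `hRic`;
(iii) apply `SubdataDevelopmentsEmbed X D 𝒟 h𝒟 (Kerr.slice a r₁) φ …`; (iv) extend `χ` off `W` by a junk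
value, unfold `IsIsometricImmersion`/`PreservesTimeOrientation` (`val_restrict`, `mfderiv_subtypeVal`), and
get the normal relation from `Theorems.SwallowTheDatum…Rigidity.mfderiv_normal_rel`.  Size M–L (plumbing). -/
theorem stub_collarEmbedsMGHD : SubdataDevelopmentsEmbed → ∀ [Kerr.Facts] (X : Type) [TopologicalSpace X]
    [ChartedSpace E3 X] [IsManifold (𝓡 3) ((⊤ : ℕ∞) : WithTop ℕ∞) X] [T2Space X]
    [SecondCountableTopology X] [ConnectedSpace X] (D : InitialDataSet (𝓡 3) X)
    (M a r₁ : ℝ) (hM : 0 ≤ M) (φ : Kerr.slice a r₁ → X)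
    (ψ : Kerr.slice a r₁ → Kerr.region a r₁) (ν : NormalField 𝓘(ℝ, E4) ψ),
    |a| < M → Kerr.rMinus M a < r₁ → r₁ < Kerr.rPlus M a →
    Topology.IsOpenEmbedding φ → ContMDiff 𝓘(ℝ, E3) (𝓡 3) ((⊤ : ℕ∞) : WithTop ℕ∞) φ →
    (∀ y : Kerr.slice a r₁, (ψ y : E4) =
        E4.ofTimeSpace (bentHeight M a (Kerr.radius a (E4.ofTimeSpace 0 (y : E3)))) (y : E3)) →
    (Kerr.smoothMetric M a r₁).IsSpacelikeImmersion 𝓘(ℝ, E3) ψ →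
    (Kerr.smoothMetric M a r₁).IsFutureUnitNormal 𝓘(ℝ, E3)
        ((Kerr.timeOrientation M a r₁ hM).ofLE le_top) ψ ν →
    (∀ (y : Kerr.slice a r₁) (v w : E3),
        D.h.inner (φ y) (mfderiv 𝓘(ℝ, E3) (𝓡 3) φ y v) (mfderiv 𝓘(ℝ, E3) (𝓡 3) φ y w) =
          Kerr.bilin M a (ψ y : E4) (mfderiv 𝓘(ℝ, E3) 𝓘(ℝ, E4) ψ y v)
            (mfderiv 𝓘(ℝ, E3) 𝓘(ℝ, E4) ψ y w)) →
    (∀ [(Kerr.smoothMetric M a r₁).HasLeviCivita] (y : Kerr.slice a r₁) (v w : E3),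
        D.k (φ y) (mfderiv 𝓘(ℝ, E3) (𝓡 3) φ y v) (mfderiv 𝓘(ℝ, E3) (𝓡 3) φ y w) =
          (Kerr.smoothMetric M a r₁).secondFundamentalForm 𝓘(ℝ, E3) ψ ν y v w) →
    (∀ (γ : ℝ → Kerr.region a r₁) (s : Set ℝ), s.OrdConnected → s.Nonempty →
      (Kerr.smoothMetric M a r₁).IsFutureTimelikeCurveOn
          ((Kerr.timeOrientation M a r₁ hM).ofLE le_top) γ s →
      (∀ t ∈ s, 0 < (γ t : E4) 0 - bentHeight M a (Kerr.radius a (γ t : E4)) +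
          (Kerr.radius a (γ t : E4) - r₁) / 4) →
      (∀ q : Kerr.region a r₁, 0 < (q : E4) 0 - bentHeight M a (Kerr.radius a (q : E4)) +
          (Kerr.radius a (q : E4) - r₁) / 4 →
            ¬ HasFutureEndpoint γ s q ∧ ¬ HasPastEndpoint γ s q) →
      ∃! t, t ∈ s ∧ (γ t : E4) 0 = bentHeight M a (Kerr.radius a (γ t : E4))) →
    Kerr.isRicciFlat M a r₁ →
    ∀ 𝒟 : VacuumCauchyDevelopment D, 𝒟.IsMaximal →
      ∃ χ : Kerr.region a r₁ → 𝒟.carrier,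
        ContMDiffOn 𝓘(ℝ, E4) (𝓡 4) ((⊤ : ℕ∞) : WithTop ℕ∞) χ
          {x | 0 < (x : E4) 0 - bentHeight M a (Kerr.radius a (x : E4)) +
            (Kerr.radius a (x : E4) - r₁) / 4} ∧
        Topology.IsOpenEmbedding (Set.restrict {x : Kerr.region a r₁ |
          0 < (x : E4) 0 - bentHeight M a (Kerr.radius a (x : E4)) +
            (Kerr.radius a (x : E4) - r₁) / 4} χ) ∧
        (∀ x : Kerr.region a r₁, 0 < (x : E4) 0 - bentHeight M a (Kerr.radius a (x : E4)) +
            (Kerr.radius a (x : E4) - r₁) / 4 →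
          (∀ v w : E4, 𝒟.metric.val (χ x) (mfderiv 𝓘(ℝ, E4) (𝓡 4) χ x v)
              (mfderiv 𝓘(ℝ, E4) (𝓡 4) χ x w) = Kerr.bilin M a (x : E4) v w) ∧
          𝒟.metric.val (χ x) (𝒟.timeOrientation.vectorField (χ x))
              (mfderiv 𝓘(ℝ, E4) (𝓡 4) χ x (Kerr.timeVector M a (x : E4))) < 0) ∧
        (∀ y : Kerr.slice a r₁, χ (ψ y) = 𝒟.embed (φ y)) ∧
        (∀ y : Kerr.slice a r₁, mfderiv 𝓘(ℝ, E4) (𝓡 4) χ (ψ y) (ν y) = 𝒟.normal (φ y)) := by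
  sorry

/-! ## S4 — Kerr optics from the bent leaf (clause (a), chart side) -/

/-- **S4 `stub_kerrLeafSojourn` — sojourn completeness of the Kerr chart seen from the bent leaf.**
For sub-extremal `(M, a)`, `0 ≤ M`, `r₋ < r₁ < r₊`, `ψ` the graph of `T` over `Kerr.slice a r₁` and `ν`
its future unit normal: there is `R₀` such that for every `s > 0` there is `R₁` such that every
normalised future null ray `γ` of `g_{M,a}` (maximal geodesic in the chart, `γ 0 = ψ y`,
`g(γ′0, ν y) = −1`) starting at a leaf point of Kerr–Schild radius `≥ R₁` is either FUTURE COMPLETE in the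
chart (`[0, ∞) ⊆ dom`) or spends affine time `≥ s` in `J⁺(ψ{r ≤ R₀})` (Kerr causal future in the chart).
Why true (Disproof §C2 + cards two-speed-optics-sojourn / speed-limit-energy-floor, triage N1/T1/T3): the
outer cone `|ẋ⃗| ≤ ṫ*` (`KerrSchild.Background.coneCovector_causal`), the conserved Killing energy
`E = −g(γ′, ∂_{t*})` with the pinch `(1 − 4H)ṫ* ≤ E ≤ ṫ*` (`E ∈ [0.93, 0.97]` for bent-normalised rays,
`R₁ ≥ 16M`), and the inner cone `(r + 2M)|v⃗| < (r − 2M)v⁰ ⇒ g(v,v) < 0` give: a ray from radius `R_p`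
enters `J⁺(ψ{r ≤ R₀})` (behind the front of speed `κ(r) = (r−2M)/(r+2M)` issued from radius `R₀`) at radius
`≥ (R_p + R₀)/2 − 1.1 M log R_p − C`, after which it needs affine time `≥ (r_entry − r₊)/(C(M,a) E)`
before `r = r₊ > r₁` (crossing `r₊` is the only way to leave the chart to the future in finite affine time:
hole clock + escape lemma); rays that never reach `r₊` (scattered, or asymptotic to the photon region) have
`t* → ∞` with `ṫ* ≤ 2E`, hence unbounded affine parameter: `[0, ∞) ⊆ dom` (escape lemma — bounded coordinate
velocity on bounded `t*`-ranges ⇒ extendible — via `exists_uniform_isGeodesicOn_of_isCompact`, `GeodesicMaximal`).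
`J⁺` is future-hereditary, so the sojourn is banked before the ray can see the core.
Size L (first Kerr null-geodesic API in the tree: Killing energy conservation
`OpensChart.hasDerivAt_momentum_of_isGeodesicOn` + `Kerr.isKillingField_stationaryField_holds`). -/
theorem stub_kerrLeafSojourn : ∀ [Kerr.Facts] (M a r₁ : ℝ) (hM : 0 ≤ M), |a| < M →
    Kerr.rMinus M a < r₁ → r₁ < Kerr.rPlus M a →
    ∀ (ψ : Kerr.slice a r₁ → Kerr.region a r₁) (ν : NormalField 𝓘(ℝ, E4) ψ),
    (∀ y : Kerr.slice a r₁, (ψ y : E4) =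
        E4.ofTimeSpace (bentHeight M a (Kerr.radius a (E4.ofTimeSpace 0 (y : E3)))) (y : E3)) →
    (Kerr.smoothMetric M a r₁).IsFutureUnitNormal 𝓘(ℝ, E3)
        ((Kerr.timeOrientation M a r₁ hM).ofLE le_top) ψ ν →
    ∀ [(Kerr.smoothMetric M a r₁).HasLeviCivita],
    ∃ R₀ : ℝ, ∀ s : ℝ, 0 < s → ∃ R₁ : ℝ, ∀ y : Kerr.slice a r₁,
      R₁ ≤ Kerr.radius a (E4.ofTimeSpace 0 (y : E3)) →
      ∀ (γ : ℝ → Kerr.region a r₁) (dom : Set ℝ),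
        (Kerr.smoothMetric M a r₁).IsNormalisedNullRayFrom
            ((Kerr.timeOrientation M a r₁ hM).ofLE le_top) ψ ν y γ dom →
        Set.Ici (0 : ℝ) ⊆ dom ∨
          ENNReal.ofReal s ≤ sojournTime γ dom
            ((Kerr.smoothMetric M a r₁).causalFuture ((Kerr.timeOrientation M a r₁ hM).ofLE le_top)
              (ψ '' {y' : Kerr.slice a r₁ | Kerr.radius a (E4.ofTimeSpace 0 (y' : E3)) ≤ R₀})) := by
  sorry

/-! ## S5 — clause (a): transport of the sojourn estimate through `χ`, inner-edge capping -/

/-- **S5 `stub_scriTransport` — complete future null infinity of every development containing the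
collar.**  For an ADMISSIBLE shielded datum (`hD`: completeness is load-bearing, Disproof §H1) with
compact core `(range φ)ᶜ`, a vacuum Cauchy development `𝒟` of `D` (maximality NOT needed) and a chart map
`χ` with the S3 properties on `W`, the Kerr-side estimate S4 (hypothesis `hray`) gives
`HasCompleteNullInfinity 𝒟`.  Proof plan (cards speed-limit-energy-floor step (6) / Disproof §H3 /
triage S2): `B₀ := X ∖ φ{r > R₀}` and `B₁ := X ∖ φ{r > R₁}` are COMPACT — closed, and
`φ({r₁ < r ≤ R})` is totally bounded for `d_h` because `φ` is a Riemannian isometry onto its open range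
(`hh`) and the Kerr–Schild slice metric is bounded near the inner edge, while `(X, h)` is complete
(`hD`, with `[D.metric.HasLeviCivita]` from `PseudoRiemannianMetric.hasLeviCivita`); for `p = φ y ∉ B₁` a
normalised `𝒟`-ray `γ` from `ι p = χ(ψ y)` has `γ′0 = dχ(L)` with `L` null, future, `g(L, ν y) = −1`
(`hχg`, `hχν`); the maximal Kerr geodesic `γ_K` with data `(ψ y, L)` stays in `{u ≥ 0} ⊆ W` for `t ≥ 0`
(`u` is a time function), `χ ∘ γ_K` is a `𝒟`-geodesic with the same data, so by maximality of `γ`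
(`IsMaximalGeodesicOn`, `GeodesicMaximal`/`GeodesicExtension`) `dom ⊇ dom_K ∩ [0, ∞)` and `γ = χ ∘ γ_K`
there; `[0,∞) ⊆ dom_K ⇒ ¬ BddAbove dom`, and `χ(J⁺_K(ψ{r ≤ R₀})) ⊆ J⁺_𝒟(ι B₀)` (push causal curves, which
stay in `{u ≥ 0}`, through `χ`; `χ ∘ ψ = ι ∘ φ`) with `sojournTime_mono`.  Size M–L. -/
theorem stub_scriTransport : ∀ [Kerr.Facts] (X : Type) [TopologicalSpace X]
    [ChartedSpace E3 X] [IsManifold (𝓡 3) ((⊤ : ℕ∞) : WithTop ℕ∞) X] [T2Space X]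
    [SecondCountableTopology X] [ConnectedSpace X] (D : InitialDataSet (𝓡 3) X),
    D ∈ admissibleVacuumData X →
    ∀ (M a r₁ : ℝ) (hM : 0 ≤ M) (φ : Kerr.slice a r₁ → X)
    (ψ : Kerr.slice a r₁ → Kerr.region a r₁) (ν : NormalField 𝓘(ℝ, E4) ψ),
    |a| < M → Kerr.rMinus M a < r₁ → r₁ < Kerr.rPlus M a →
    IsCompact (Set.range φ)ᶜ → Topology.IsOpenEmbedding φ →
    ContMDiff 𝓘(ℝ, E3) (𝓡 3) ((⊤ : ℕ∞) : WithTop ℕ∞) φ →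
    (∀ y : Kerr.slice a r₁, (ψ y : E4) =
        E4.ofTimeSpace (bentHeight M a (Kerr.radius a (E4.ofTimeSpace 0 (y : E3)))) (y : E3)) →
    (∀ (y : Kerr.slice a r₁) (v w : E3),
        D.h.inner (φ y) (mfderiv 𝓘(ℝ, E3) (𝓡 3) φ y v) (mfderiv 𝓘(ℝ, E3) (𝓡 3) φ y w) =
          Kerr.bilin M a (ψ y : E4) (mfderiv 𝓘(ℝ, E3) 𝓘(ℝ, E4) ψ y v)
            (mfderiv 𝓘(ℝ, E3) 𝓘(ℝ, E4) ψ y w)) →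
    (∀ [(Kerr.smoothMetric M a r₁).HasLeviCivita],
      ∃ R₀ : ℝ, ∀ s : ℝ, 0 < s → ∃ R₁ : ℝ, ∀ y : Kerr.slice a r₁,
        R₁ ≤ Kerr.radius a (E4.ofTimeSpace 0 (y : E3)) →
        ∀ (γ : ℝ → Kerr.region a r₁) (dom : Set ℝ),
          (Kerr.smoothMetric M a r₁).IsNormalisedNullRayFrom
              ((Kerr.timeOrientation M a r₁ hM).ofLE le_top) ψ ν y γ dom →
          Set.Ici (0 : ℝ) ⊆ dom ∨
            ENNReal.ofReal s ≤ sojournTime γ dom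
              ((Kerr.smoothMetric M a r₁).causalFuture ((Kerr.timeOrientation M a r₁ hM).ofLE le_top)
                (ψ '' {y' : Kerr.slice a r₁ | Kerr.radius a (E4.ofTimeSpace 0 (y' : E3)) ≤ R₀}))) →
    ∀ (𝒟 : VacuumCauchyDevelopment D) (χ : Kerr.region a r₁ → 𝒟.carrier),
      ContMDiffOn 𝓘(ℝ, E4) (𝓡 4) ((⊤ : ℕ∞) : WithTop ℕ∞) χ
          {x | 0 < (x : E4) 0 - bentHeight M a (Kerr.radius a (x : E4)) +
            (Kerr.radius a (x : E4) - r₁) / 4} →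
      Topology.IsOpenEmbedding (Set.restrict {x : Kerr.region a r₁ |
          0 < (x : E4) 0 - bentHeight M a (Kerr.radius a (x : E4)) +
            (Kerr.radius a (x : E4) - r₁) / 4} χ) →
      (∀ x : Kerr.region a r₁, 0 < (x : E4) 0 - bentHeight M a (Kerr.radius a (x : E4)) +
            (Kerr.radius a (x : E4) - r₁) / 4 →
          (∀ v w : E4, 𝒟.metric.val (χ x) (mfderiv 𝓘(ℝ, E4) (𝓡 4) χ x v)
              (mfderiv 𝓘(ℝ, E4) (𝓡 4) χ x w) = Kerr.bilin M a (x : E4) v w) ∧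
          𝒟.metric.val (χ x) (𝒟.timeOrientation.vectorField (χ x))
              (mfderiv 𝓘(ℝ, E4) (𝓡 4) χ x (Kerr.timeVector M a (x : E4))) < 0) →
      (∀ y : Kerr.slice a r₁, χ (ψ y) = 𝒟.embed (φ y)) →
      (∀ y : Kerr.slice a r₁, mfderiv 𝓘(ℝ, E4) (𝓡 4) χ (ψ y) (ν y) = 𝒟.normal (φ y)) →
      Summit.FinalStateConjecture.HasCompleteNullInfinity 𝒟.toCauchyDevelopment := by
  sorry

/-! ## S6 — clauses (b)+(c), chart side: the `N = 1` receding-bend decomposition of the Kerr chart -/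

/-- **S6 `stub_kerrExteriorDecomposition` — an `N = 1` final-state decomposition of the Kerr chart above the
bent leaf.**  For sub-extremal `(M,a)`, `0 ≤ M`, `r₋ < r₁ < r₊`, the Kerr spacetime `Kerr.spacetime M a r₁ hM`
carries a `FinalStateDecomposition` in `C²` of the region `O_K := {r > r₊, x⁰ ≥ T(r)}` with ONE hole
(sub-extremal mass/spin — intended `(M, a)`, motion `(1, 0)`), whose charts have ALL their values in `O_K`,
which has exhaustive charts (`HasExhaustiveCharts`), and such that `O_K ⊆ J⁺(Σᵉ)` and
`O_K ⊆ I⁻(charted late images)` in the chart.  Construction (Disproof §C3/§C4/§F/§I, cards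
one-gauge-sliding-seam + zero-mass-scaling-deviation, triage N4/N5/T5/T6): hole chart
`Ψ₁(x⁰, x⃗) = (θ(x⁰) + B(θ(x⁰), r), x⃗)`, `B = c₀ + T(r)·χ((r − 2R(x⁰))/R(x⁰))`, `R(τ) = √τ + 1`,
`θ` the smooth squeeze equal to `id` on `{x⁰ ≥ τ₀}` (so `Ψ₁` is a Kerr–Schild TIME TRANSLATION on the growing
near zone `{r < 2R}` ⇒ `truncDeviationCk ≡ 0` eventually for every `R′`; the stationary bend is refuted:
`Theorems/KerrShieldedSettles/Negative/StationaryBendDead.lean`); flat chart `Ψ₀(x⁰, x⃗) = (x⁰ + c₀ + T(r), x⃗)`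
on `flatDomain = {x⁰ > τ₀ − 1, r > ρ(x⁰)}`, `ρ = √·` (bent by the FULL `T`, as forced by
`not_exists_unbent_bound`), flat `C²` deviation `O(M/√τ) → 0` (scale covariance reduces it to continuity at
zero mass on a compact annulus); covering (ii) of `HasExhaustiveCharts` with `R₁(τ) = R(τ)` and
`diff_subset_causalPast` by climbing the fixed-`(r, θ)` helix `Kerr.isTimelike_drsrField` (timelike on the
whole sub-extremal exterior) plus reflexivity of `J⁻`; `O_K ⊆ J⁺({x⁰ = T(r)})` along the past integral curve of
`V = −g♯dt*` (`ṫ* ≥ 1`, `ṙ ≤ 0` pastward-increasing `r`, `u → −∞`); `O_K ⊆ I⁻(charted)` by the same helix into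
the (axisymmetric, `t*`-cofinal) late image of `Ψ₁`.  Size XL (the analytic bulk of the crux; natural glued
split later: charts+deviations / causal covering).  HARDEST STUB. -/
theorem stub_kerrExteriorDecomposition : ∀ [Kerr.Facts] (M a r₁ : ℝ) (hM : 0 ≤ M), |a| < M →
    Kerr.rMinus M a < r₁ → r₁ < Kerr.rPlus M a →
    ∃ dec : FinalStateDecomposition (Kerr.spacetime M a r₁ hM)
        {x : Kerr.region a r₁ | Kerr.rPlus M a < Kerr.radius a (x : E4) ∧
          bentHeight M a (Kerr.radius a (x : E4)) ≤ (x : E4) 0} 2,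
      dec.N = 1 ∧ (∀ i, Kerr.IsSubextremal (dec.mass i) (dec.spin i)) ∧
      Summit.FinalStateConjecture.HasExhaustiveCharts dec ∧
      {x : Kerr.region a r₁ | Kerr.rPlus M a < Kerr.radius a (x : E4) ∧
          bentHeight M a (Kerr.radius a (x : E4)) ≤ (x : E4) 0} ⊆
        (Kerr.smoothMetric M a r₁).causalFuture ((Kerr.timeOrientation M a r₁ hM).ofLE le_top)
          {x : Kerr.region a r₁ | (x : E4) 0 = bentHeight M a (Kerr.radius a (x : E4))} ∧
      {x : Kerr.region a r₁ | Kerr.rPlus M a < Kerr.radius a (x : E4) ∧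
          bentHeight M a (Kerr.radius a (x : E4)) ≤ (x : E4) 0} ⊆
        (Kerr.smoothMetric M a r₁).chronologicalPast ((Kerr.timeOrientation M a r₁ hM).ofLE le_top)
          dec.charted ∧
      (∀ i x, dec.chart i x ∈ {x : Kerr.region a r₁ | Kerr.rPlus M a < Kerr.radius a (x : E4) ∧
          bentHeight M a (Kerr.radius a (x : E4)) ≤ (x : E4) 0}) ∧
      (∀ x, dec.flatChart x ∈ {x : Kerr.region a r₁ | Kerr.rPlus M a < Kerr.radius a (x : E4) ∧
          bentHeight M a (Kerr.radius a (x : E4)) ≤ (x : E4) 0}) := by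
  sorry

/-! ## S7 — clauses (b)+(c), transport: exterior ignorance (Disproof §C1 last-exit) -/

/-- **S7 `stub_exteriorTransport` — the decomposition region of `𝒟` is the image of `O_K`; push the charts.**
For a shielded datum, ANY vacuum Cauchy development `𝒟` of `D` (maximality not needed), a chart map `χ` with the
S3 properties on `W` (normal relation not needed), and a Kerr-side decomposition `dec` of `O_K` as in S6:
`𝒟` carries a `FinalStateDecomposition` `d` (charts `χ ∘ dec.chart i`, `χ ∘ dec.flatChart`, all other
fields copied) of `O := χ '' O_K` with sub-extremal holes, `O = exteriorOf 𝒟 d.charted` and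
`HasExhaustiveCharts d`.  Proof plan: isometry on `W ⊇ O_K ⊇` chart images makes every deviation number
equal (chain rule; `iteratedFDeriv` locality) and every chart a smooth open embedding (composition);
`d.charted = χ '' dec.charted`, `certifiedLate/Slab d = χ '' (…)`; the causal INCLUSIONS needed
(`O ∖ certifiedLate ⊆ J⁻(certifiedSlab)`, `diff_subset_causalPast`, `O ⊆ J⁺(ιX) ∩ I⁻(charted)`) are
push-forwards through `χ` of the Kerr-side ones, the connecting causal curves lying in `{u ≥ 0} ⊆ W`
because `u = x⁰ − T(r)` is non-decreasing along future causal curves; the one REVERSE inclusion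
`J⁺_𝒟(ιX) ∩ I⁻_𝒟(χ charted) ⊆ χ(O_K)` is the LAST-EXIT ARGUMENT of Disproof §C1 run PASTWARD from a chart
point `χ(c)`: the first exit point `e ∉ χ(W)` of the past-directed timelike curve has a chart pre-history
which (speed limit + `t*` monotone) either converges in `E4` — to a point of the chart not in `W` (then the
curve crossed `χ(Σᵉ) ⊆ ιX` strictly between, contradicting ACHRONALITY of the Cauchy hypersurface `ιX`:
`IsCauchyHypersurface.eq_of_mem_of_mem_opens` + push-up `CausalityPushUp`) or to the inner edge
(contradicting the hole clock: pastward `r` increases on `r₋ < r < r₊`) — or has `t* → −∞` (crossing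
again); if the curve never exits, `p = χ(x)` with `u(x) ≥ 0` (else `x ∈ W⁻ ⊆ I⁻_W(Σᵉ)` by the taper, same
contradiction) and `r(x) > r₊` (a future-timelike curve from `r ≤ r₊` never reaches `r > r₊`:
`Kerr.horizonCovector_causal`, `Kerr.delta_le_mul_sub_rPlus`, Grönwall form — triage S3).  Hausdorffness of
`𝒟` (`Spacetime` bundles `T2Space`) identifies limits.  Size M–L. -/
theorem stub_exteriorTransport : ∀ [Kerr.Facts] (X : Type) [TopologicalSpace X]
    [ChartedSpace E3 X] [IsManifold (𝓡 3) ((⊤ : ℕ∞) : WithTop ℕ∞) X] [T2Space X]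
    [SecondCountableTopology X] [ConnectedSpace X] (D : InitialDataSet (𝓡 3) X)
    (M a r₁ : ℝ) (hM : 0 ≤ M) (φ : Kerr.slice a r₁ → X)
    (ψ : Kerr.slice a r₁ → Kerr.region a r₁),
    |a| < M → Kerr.rMinus M a < r₁ → r₁ < Kerr.rPlus M a →
    (∀ y : Kerr.slice a r₁, (ψ y : E4) =
        E4.ofTimeSpace (bentHeight M a (Kerr.radius a (E4.ofTimeSpace 0 (y : E3)))) (y : E3)) →
    ∀ (𝒟 : VacuumCauchyDevelopment D) (χ : Kerr.region a r₁ → 𝒟.carrier),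
      ContMDiffOn 𝓘(ℝ, E4) (𝓡 4) ((⊤ : ℕ∞) : WithTop ℕ∞) χ
          {x | 0 < (x : E4) 0 - bentHeight M a (Kerr.radius a (x : E4)) +
            (Kerr.radius a (x : E4) - r₁) / 4} →
      Topology.IsOpenEmbedding (Set.restrict {x : Kerr.region a r₁ |
          0 < (x : E4) 0 - bentHeight M a (Kerr.radius a (x : E4)) +
            (Kerr.radius a (x : E4) - r₁) / 4} χ) →
      (∀ x : Kerr.region a r₁, 0 < (x : E4) 0 - bentHeight M a (Kerr.radius a (x : E4)) +
            (Kerr.radius a (x : E4) - r₁) / 4 →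
          (∀ v w : E4, 𝒟.metric.val (χ x) (mfderiv 𝓘(ℝ, E4) (𝓡 4) χ x v)
              (mfderiv 𝓘(ℝ, E4) (𝓡 4) χ x w) = Kerr.bilin M a (x : E4) v w) ∧
          𝒟.metric.val (χ x) (𝒟.timeOrientation.vectorField (χ x))
              (mfderiv 𝓘(ℝ, E4) (𝓡 4) χ x (Kerr.timeVector M a (x : E4))) < 0) →
      (∀ y : Kerr.slice a r₁, χ (ψ y) = 𝒟.embed (φ y)) →
      ∀ dec : FinalStateDecomposition (Kerr.spacetime M a r₁ hM)
          {x : Kerr.region a r₁ | Kerr.rPlus M a < Kerr.radius a (x : E4) ∧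
            bentHeight M a (Kerr.radius a (x : E4)) ≤ (x : E4) 0} 2,
        (∀ i, Kerr.IsSubextremal (dec.mass i) (dec.spin i)) →
        Summit.FinalStateConjecture.HasExhaustiveCharts dec →
        {x : Kerr.region a r₁ | Kerr.rPlus M a < Kerr.radius a (x : E4) ∧
            bentHeight M a (Kerr.radius a (x : E4)) ≤ (x : E4) 0} ⊆
          (Kerr.smoothMetric M a r₁).causalFuture ((Kerr.timeOrientation M a r₁ hM).ofLE le_top)
            {x : Kerr.region a r₁ | (x : E4) 0 = bentHeight M a (Kerr.radius a (x : E4))} →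
        {x : Kerr.region a r₁ | Kerr.rPlus M a < Kerr.radius a (x : E4) ∧
            bentHeight M a (Kerr.radius a (x : E4)) ≤ (x : E4) 0} ⊆
          (Kerr.smoothMetric M a r₁).chronologicalPast ((Kerr.timeOrientation M a r₁ hM).ofLE le_top)
            dec.charted →
        (∀ i x, dec.chart i x ∈ {x : Kerr.region a r₁ | Kerr.rPlus M a < Kerr.radius a (x : E4) ∧
            bentHeight M a (Kerr.radius a (x : E4)) ≤ (x : E4) 0}) →
        (∀ x, dec.flatChart x ∈ {x : Kerr.region a r₁ | Kerr.rPlus M a < Kerr.radius a (x : E4) ∧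
            bentHeight M a (Kerr.radius a (x : E4)) ≤ (x : E4) 0}) →
        ∃ (O : Set 𝒟.carrier) (d : FinalStateDecomposition 𝒟.toSpacetime O 2),
          (∀ i, Kerr.IsSubextremal (d.mass i) (d.spin i)) ∧
          O = Summit.FinalStateConjecture.exteriorOf 𝒟.toCauchyDevelopment d.charted ∧
          Summit.FinalStateConjecture.HasExhaustiveCharts d := by
  sorry

/-! ## The composition (kernel-checked; no `sorry` of its own) -/

/-- **`KerrShieldedSettles` from S1–S7 and the route item `SubdataDevelopmentsEmbed` (10053, by name).**
Pure logic: unpack the shield; rewrite the hard-coded height as `bentHeight M a` (`rfl`); unfold the two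
pull-back identities pointwise; obtain `χ` from S3 (fed S1 and S2); clause (a) is S5 fed S4; clauses
(b)+(c) are S7 fed S6. -/
theorem KerrShieldedSettles_of (hE : SubdataDevelopmentsEmbed) : KerrShieldedSettles := by
  intro hKF X _ _ _ _ _ _ D hD hS 𝒟 h𝒟
  obtain ⟨M, a, r₁, hM, T, φ, ψ, ν, ha, hr₁, hr₂, hT, hK, hφo, hφs, hψ, hsp, hν, hh, hk⟩ := hS
  have hT' : T = bentHeight M a := hT.trans (bentHeight_eq_literal M a).symm
  subst hT'
  -- the two pull-back identities, pointwise
  have hh' : ∀ (y : Kerr.slice a r₁) (v w : E3),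
      D.h.inner (φ y) (mfderiv 𝓘(ℝ, E3) (𝓡 3) φ y v) (mfderiv 𝓘(ℝ, E3) (𝓡 3) φ y w) =
        Kerr.bilin M a (ψ y : E4) (mfderiv 𝓘(ℝ, E3) 𝓘(ℝ, E4) ψ y v)
          (mfderiv 𝓘(ℝ, E3) 𝓘(ℝ, E4) ψ y w) := fun y v w => by
    have h := congrArg (fun b => b v w) (hh y)
    simp only [pullbackBilin_apply, Kerr.smoothMetric_val] at h
    convert h using 2 <;> rfl
  have hk' : ∀ [(Kerr.smoothMetric M a r₁).HasLeviCivita] (y : Kerr.slice a r₁) (v w : E3),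
      D.k (φ y) (mfderiv 𝓘(ℝ, E3) (𝓡 3) φ y v) (mfderiv 𝓘(ℝ, E3) (𝓡 3) φ y w) =
        (Kerr.smoothMetric M a r₁).secondFundamentalForm 𝓘(ℝ, E3) ψ ν y v w := by
    intro _ y v w
    have h := congrArg (fun B => B v w) (hk y)
    simp only [ContinuousLinearMap.toLinearMap₁₂_apply, pullbackBilin_apply] at h
    convert h using 2
  obtain ⟨χ, hχs, hχe, hχg, hχψ, hχν⟩ :=
    stub_collarEmbedsMGHD hE X D M a r₁ hM φ ψ ν ha hr₁ hr₂ hφo hφs hψ hsp hν hh' hk'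
      (stub_collarCauchy M a r₁ hM ha hr₁ hr₂) (stub_kerrVacuum M a r₁) 𝒟 h𝒟
  refine ⟨stub_scriTransport X D hD M a r₁ hM φ ψ ν ha hr₁ hr₂ hK hφo hφs hψ hh'
      (stub_kerrLeafSojourn M a r₁ hM ha hr₁ hr₂ ψ ν hψ hν) 𝒟 χ hχs hχe hχg hχψ hχν, ?_⟩
  obtain ⟨dec, -, hsub, hex, hJ, hI, hin, hin₀⟩ :=
    stub_kerrExteriorDecomposition M a r₁ hM ha hr₁ hr₂
  exact stub_exteriorTransport X D M a r₁ hM φ ψ ha hr₁ hr₂ hψ 𝒟 χ hχs hχe hχg hχψ dec hsub hex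
    hJ hI hin hin₀

end Summit.FinalStateConjecture.FinalStateConjecture.Cruxes.KerrShieldedSettles.TaperedTemporalCollar

end
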